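import Summits.RiemannHypothesis.RiemannHypothesis.Theorems.WeilFormatCFamilyGram
import HarnessLib

/-!
# Format C, design C∞ (E3, analytic side): the family Gram majorant over a `Fintype` index, and `Γ(u(z))` as a quadratic form in `z`

Route context: Fourier–Galerkin / Schur-complement certificates of Weil positivity on a window ("format C", C∞ door;
cell memo `run/shared/lean/pub/rh-explicit/rh-explicit-weil-10/KERNEL-LEVER.md` §21; supporting stmt-RiemannHypothesis-0098;
seat rh-explicit-weil-10).  Two pieces of generic algebra for the DATA side of `cinf_hUq_even/odd`:

* `sum_Ico_sq_sum_mul_le_of_boxes_fintype` — `sum_Ico_sq_sum_mul_le_of_boxes` (`WeilFormatCFamilyGram`: an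
  `N`-uniform majorant `Γ(u) = uᵀΓmid u + Σ_f u_f² Σ_{f'} ρ_{ff'}ν_{f'}/ν_f` of `Σ_m (Σ_f u_f φ_f(m))²` from ENTRY BOXES
  of the family Gram) over any `Fintype` family index (the (tag, power) pairs);
* `sum4_comm`, `gramMajorant_comp_linear` — for `u_f = Σ_k A(f,k) z_k`:
  `Σ_f Σ_{f'} u_f u_{f'} G(f,f') + Σ_f c_f u_f² = Σ_k Σ_{k'} z_k z_{k'} [Σ_f Σ_{f'} A(f,k)A(f',k')G(f,f') + Σ_f c_f A(f,k)A(f,k')]`,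
  so the `Γ(u(x,β))` term of `Uqe/Uqo` is an explicit quadratic form whose matrix the generator boxes;
* `linearForm_sum_elim` — the two-block coefficient vector `(x, β)` as one vector on `Fin B ⊕ Fin r`.

Pure finite-dimensional algebra; standard axioms; no definitions; no RH claim.
-/

set_option autoImplicit false
-- `Summit.RiemannHypothesis.RiemannHypothesis.…` is the layout-mandated namespace (summit = problem name).
set_option linter.dupNamespace false

namespace Summit.RiemannHypothesis.RiemannHypothesis.Theorems.WeilFormatC

open Finset

/-! ## The box majorant over a `Fintype` index -/

/-- **Family Gram majorant from entry boxes, `Fintype` index**: verbatim `sum_Ico_sq_sum_mul_le_of_boxes` with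
`Fin F` replaced by any finite index type. -/
theorem sum_Ico_sq_sum_mul_le_of_boxes_fintype {ι : Type*} [Fintype ι] (φ : ι → ℕ → ℝ) (B₃ : ℕ)
    (hφ : ∀ f, Summable fun k : ℕ ↦ φ f (B₃ + k) ^ 2) (Γmid ρ : ι → ι → ℝ)
    (hbox : ∀ f f', |(∑' k : ℕ, φ f (B₃ + k) * φ f' (B₃ + k)) - Γmid f f'| ≤ ρ f f')
    (hρ : ∀ f f', ρ f f' = ρ f' f) (ν : ι → ℝ) (hν : ∀ f, 0 < ν f) (N : ℕ) (u : ι → ℝ) :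
    ∑ m ∈ Finset.Ico B₃ N, (∑ f, u f * φ f m) ^ 2
      ≤ (∑ f, ∑ f', u f * u f' * Γmid f f') + ∑ f, u f ^ 2 * ∑ f', ρ f f' * ν f' / ν f := by
  classical
  set e := Fintype.equivFin ι with he
  have hsum : ∀ g : ι → ℝ, ∑ f : Fin (Fintype.card ι), g (e.symm f) = ∑ x : ι, g x :=
    fun g ↦ Equiv.sum_comp e.symm g
  have h := sum_Ico_sq_sum_mul_le_of_boxes (fun f ↦ φ (e.symm f)) B₃ (fun f ↦ hφ (e.symm f))
    (fun f f' ↦ Γmid (e.symm f) (e.symm f')) (fun f f' ↦ ρ (e.symm f) (e.symm f'))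
    (fun f f' ↦ hbox (e.symm f) (e.symm f')) (fun f f' ↦ hρ (e.symm f) (e.symm f'))
    (fun f ↦ ν (e.symm f)) (fun f ↦ hν (e.symm f)) N (fun f ↦ u (e.symm f))
  have e1 : ∀ m, ∑ f : Fin (Fintype.card ι), u (e.symm f) * φ (e.symm f) m = ∑ x : ι, u x * φ x m :=
    fun m ↦ hsum (fun x ↦ u x * φ x m)
  have e2 : ∑ f : Fin (Fintype.card ι), ∑ f' : Fin (Fintype.card ι),
      u (e.symm f) * u (e.symm f') * Γmid (e.symm f) (e.symm f') = ∑ x : ι, ∑ x' : ι, u x * u x' * Γmid x x' := by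
    rw [← hsum (fun x ↦ ∑ x' : ι, u x * u x' * Γmid x x')]
    exact Finset.sum_congr rfl fun f _ ↦ hsum (fun x' ↦ u (e.symm f) * u x' * Γmid (e.symm f) x')
  have e3 : ∑ f : Fin (Fintype.card ι), u (e.symm f) ^ 2 *
      ∑ f' : Fin (Fintype.card ι), ρ (e.symm f) (e.symm f') * ν (e.symm f') / ν (e.symm f)
      = ∑ x : ι, u x ^ 2 * ∑ x' : ι, ρ x x' * ν x' / ν x := by
    rw [← hsum (fun x ↦ u x ^ 2 * ∑ x' : ι, ρ x x' * ν x' / ν x)]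
    exact Finset.sum_congr rfl fun f _ ↦ by rw [hsum (fun x' ↦ ρ (e.symm f) x' * ν x' / ν (e.symm f))]
  simp only [e1] at h
  rw [e2, e3] at h
  exact h

/-! ## `Γ(u(z))` as a quadratic form in `z` -/

/-- Commuting a quadruple sum: `Σ_f Σ_{f'} Σ_k Σ_{k'} = Σ_k Σ_{k'} Σ_f Σ_{f'}`. -/
theorem sum4_comm {ι κ : Type*} [Fintype ι] [Fintype κ] (F : ι → ι → κ → κ → ℝ) :
    ∑ f, ∑ f', ∑ k, ∑ k', F f f' k k' = ∑ k, ∑ k', ∑ f, ∑ f', F f f' k k' := by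
  have h1 : ∀ f : ι, ∑ f', ∑ k, ∑ k', F f f' k k' = ∑ k, ∑ k', ∑ f', F f f' k k' := by
    intro f
    rw [Finset.sum_comm]
    exact Finset.sum_congr rfl fun k _ ↦ Finset.sum_comm
  simp_rw [h1]
  rw [Finset.sum_comm]
  exact Finset.sum_congr rfl fun k _ ↦ Finset.sum_comm

/-- **`Γ(u(z))` as a quadratic form in `z`**: for `u_f = Σ_k A(f,k)z_k`,
`Σ_f Σ_{f'} u_f u_{f'} G(f,f') + Σ_f c_f u_f² = Σ_k Σ_{k'} z_k z_{k'}(Σ_f Σ_{f'} A(f,k)A(f',k')G(f,f') + Σ_f c_f A(f,k)A(f,k'))`. -/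
theorem gramMajorant_comp_linear {ι κ : Type*} [Fintype ι] [Fintype κ] (G : ι → ι → ℝ) (c : ι → ℝ)
    (A : ι → κ → ℝ) (z : κ → ℝ) :
    (∑ f, ∑ f', (∑ k, A f k * z k) * (∑ k, A f' k * z k) * G f f') + ∑ f, c f * (∑ k, A f k * z k) ^ 2
      = ∑ k, ∑ k', z k * z k' * ((∑ f, ∑ f', A f k * A f' k' * G f f') + ∑ f, c f * A f k * A f k') := by
  -- expand the products of sums
  have h1 : ∀ f f', (∑ k, A f k * z k) * (∑ k, A f' k * z k) * G f f'
      = ∑ k, ∑ k', z k * z k' * (A f k * A f' k' * G f f') := by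
    intro f f'
    rw [Finset.sum_mul_sum, Finset.sum_mul]
    refine Finset.sum_congr rfl fun k _ ↦ ?_
    rw [Finset.sum_mul]
    exact Finset.sum_congr rfl fun k' _ ↦ by ring
  have h2 : ∀ f, c f * (∑ k, A f k * z k) ^ 2 = ∑ k, ∑ k', z k * z k' * (c f * A f k * A f k') := by
    intro f
    rw [sq, Finset.sum_mul_sum, Finset.mul_sum]
    refine Finset.sum_congr rfl fun k _ ↦ ?_
    rw [Finset.mul_sum]
    exact Finset.sum_congr rfl fun k' _ ↦ by ring
  simp_rw [h1, h2]
  rw [sum4_comm (fun f f' k k' ↦ z k * z k' * (A f k * A f' k' * G f f'))]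
  have h3 : ∑ f, ∑ k, ∑ k', z k * z k' * (c f * A f k * A f k') = ∑ k, ∑ k', ∑ f, z k * z k' * (c f * A f k * A f k') := by
    rw [Finset.sum_comm]
    exact Finset.sum_congr rfl fun k _ ↦ Finset.sum_comm
  rw [h3, ← Finset.sum_add_distrib]
  refine Finset.sum_congr rfl fun k _ ↦ ?_
  rw [← Finset.sum_add_distrib]
  refine Finset.sum_congr rfl fun k' _ ↦ ?_
  rw [mul_add, Finset.mul_sum, Finset.mul_sum]
  congr 1
  exact Finset.sum_congr rfl fun f _ ↦ by rw [Finset.mul_sum]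

/-- **Two blocks as one vector**: with `z = (x, β)` on `Fin B ⊕ Fin r` and `A(f,·) = (P(f,·), Q(f,·))`,
`Σ_k A(f,k) z_k = Σ_i P(f,i)x_i + Σ_j Q(f,j)β_j`. -/
theorem linearForm_sum_elim {B r : ℕ} (P : Fin B → ℝ) (Q : Fin r → ℝ) (x : Fin B → ℝ) (β : Fin r → ℝ) :
    ∑ k : Fin B ⊕ Fin r, Sum.elim P Q k * Sum.elim x β k = ∑ i, P i * x i + ∑ j, Q j * β j := by
  rw [Fintype.sum_sum_type]
  simp only [Sum.elim_inl, Sum.elim_inr]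

/-- The squared norm of the two blocks as one vector: `Σ_k z_k² = Σ_i x_i² + Σ_j β_j²`. -/
theorem sq_norm_sum_elim {B r : ℕ} (x : Fin B → ℝ) (β : Fin r → ℝ) :
    ∑ k : Fin B ⊕ Fin r, Sum.elim x β k ^ 2 = ∑ i, x i ^ 2 + ∑ j, β j ^ 2 := by
  rw [Fintype.sum_sum_type]
  simp only [Sum.elim_inl, Sum.elim_inr]

end Summit.RiemannHypothesis.RiemannHypothesis.Theorems.WeilFormatC
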